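import Summits.AtomisticToContinuum.BoseEinsteinCondensation.Theorems.BECConjugateDominationInfraredMinimumUncertaintyFreeFisherGaussianity
import Summits.AtomisticToContinuum.BoseEinsteinCondensation.Theorems.InfraredMinimumUncertainty.Negative.MinimalityLoadBearing

/-!
# Repair suggestion (drefute seat) for the fallback density-side cut of line `fisher-gaussian-density-mode`

Crux `InfraredMinimumUncertainty` (stmt-AtomisticToContinuum-11784), gen-2 skeleton.  The typed fallback
`StructureFactorCeiling` (SFC: `S_m ≤ C‖k‖/√(‖k‖² + ρ)`) is FALSE at the free gas
(`Theorems/InfraredMinimumUncertainty/Negative/StructureFactorCeilingFalse.lean`): the ideal gas has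
`S ≡ 1`, and the healing scale `ρ` presumes an interaction (`16πρa` with `a > 0`).  Minimal repair,
typed and glued here so that the lead / planner can adopt it in one edit:

* `MomentBoundsTheta` — the JOINT moment bounds with an interaction scale `Θ = Θ(v) ≥ 0` chosen per
  potential together with `C` (`Θ = 0` allowed): `m₂ ≤ C N‖k‖³√(‖k‖² + Θρ)` AND `S_m ≤ C‖k‖/√(‖k‖² + Θρ)`.
  (Two separate statements each with its own `∃Θ` would not compose: `Θ_SFC = 0` forces `Θ_SMB = 0`.)
* `feynmanSaturation_of_momentBoundsTheta` — the glue `MomentBoundsTheta ⇒ FeynmanSaturation (C²)`,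
  so the proved `imu_of_densityMoment` still closes the crux from `{DMD, MomentBoundsTheta}`.
* `momentBoundsTheta_at_free` — the free gas (`v ≡ 0`) SATISFIES the repaired statement with `C = 1`,
  `Θ = 0`, every `ρ₀`, every `n` (constant minimiser: `m₂ = N‖k‖⁴`, `S_m = 1`): the SFC witness misses
  the repair.

Evidence file only (not a proposal); elaborates against the tree (`lean check` rc 0).
-/

noncomputable section

open MeasureTheory Filter Set
open scoped ENNReal NNReal Topology BigOperators

namespace Summit.AtomisticToContinuum.BoseEinsteinCondensation.Cruxes.InfraredMinimumUncertainty.DrefuteRepair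

open Literature.MathematicalPhysics.QuantumManyBody.BoseGas
open Summit.AtomisticToContinuum.BoseEinsteinCondensation.Cruxes.InfraredMinimumUncertainty.FisherGaussianDensityMode
open Summit.AtomisticToContinuum.BoseEinsteinCondensation.Theorems.InfraredMinimumUncertainty.Negative
  (inSmoothClass_zero exists_eq_const_of_free_minimiser)
open Summit.AtomisticToContinuum.BoseEinsteinCondensation.Theorems.BECConjugateDomination
  (integral_norm_sq_densityMode_of_const fderiv_eq_zero_of_free_minimiser)
open Summit.AtomisticToContinuum.BoseEinsteinCondensation.Theorems.CorrectorClosure.Negative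
  (sideLength_succ_pos)

/-- **The repaired density-side fallback (joint moment bounds with an interaction scale).**
For every smooth-class `v` there are `C ≥ 0`, `Θ ≥ 0`, `ρ₀ > 0` such that for `0 < ρ < ρ₀`,
eventually in `N`, for every positive minimiser and every `m ≠ 0`:
`m₂ ≤ C N ‖k‖³ √(‖k‖² + Θρ)` and `S_m ≤ C ‖k‖ / √(‖k‖² + Θρ)`.
Bogoliubov: `Θ = 16πa(v)`, `C = 1`; free gas: `Θ = 0`, `C = 1`. A statement, not a fact. [folklore] -/
def MomentBoundsTheta : Prop :=
  ∀ v : ℝ → ℝ≥0∞, IsRepulsiveFiniteRange v → (∀ r, v r ≠ ⊤) →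
    ContDiff ℝ 2 (fun x : Space => (v ‖x‖).toReal) →
    (∃ Cₑ : ℝ, ∀ x : Space,
      ‖iteratedFDeriv ℝ 2 (fun x : Space => (v ‖x‖).toReal) x‖ ≤ Cₑ * Real.sqrt ((v ‖x‖).toReal)) →
    ∃ C : ℝ, 0 ≤ C ∧ ∃ Θ : ℝ, 0 ≤ Θ ∧ ∃ ρ₀ : ℝ, 0 < ρ₀ ∧ ∀ ρ : ℝ, 0 < ρ → ρ < ρ₀ →
      ∀ᶠ n : ℕ in atTop, ∀ Ψ : PeriodicTrialState (n + 1) (sideLength ρ (n + 1)),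
        periodicEnergy v Ψ = periodicGroundStateEnergy v (n + 1) (sideLength ρ (n + 1)) →
        periodicEnergy v Ψ ≠ ⊤ → (∀ X, Ψ.ψ X = (‖Ψ.ψ X‖ : ℂ)) → (∀ X, Ψ.ψ X ≠ 0) →
        ∀ m : Fin 3 → ℤ, m ≠ 0 →
          secondMoment (n + 1) (sideLength ρ (n + 1)) Ψ.ψ m ≤
              C * ((n : ℝ) + 1) * ‖waveVec (sideLength ρ (n + 1)) m‖ ^ 3 *
                Real.sqrt (‖waveVec (sideLength ρ (n + 1)) m‖ ^ 2 + Θ * ρ) ∧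
            structureFactor n (sideLength ρ (n + 1)) Ψ m ≤
              C * ‖waveVec (sideLength ρ (n + 1)) m‖ /
                Real.sqrt (‖waveVec (sideLength ρ (n + 1)) m‖ ^ 2 + Θ * ρ)

/-- `m₂ ≥ 0`. [folklore] -/
theorem secondMoment_nonneg' (N : ℕ) (L : ℝ) (ψ : Config N → ℂ) (m : Fin 3 → ℤ) :
    0 ≤ secondMoment N L ψ m :=
  integral_nonneg fun X => by positivity

/-- **Glue: the repaired joint bounds imply Feynman saturation** with constant `C²`:
`(N S_m)·m₂ ≤ (N C‖k‖/s)(C N‖k‖³ s) = C² N²‖k‖⁴`, `s = √(‖k‖² + Θρ) > 0`. [folklore] -/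
theorem feynmanSaturation_of_momentBoundsTheta (h : MomentBoundsTheta) : FeynmanSaturation := by
  intro v hv₁ hv₂ hv₃ hv₄
  obtain ⟨C, hC, Θ, hΘ, ρ₀, hρ₀, H⟩ := h v hv₁ hv₂ hv₃ hv₄
  refine ⟨C * C, by positivity, ρ₀, hρ₀, fun ρ hρ hρρ₀ => ?_⟩
  filter_upwards [H ρ hρ hρρ₀] with n hn
  intro Ψ hE hfin hreal hpos m hm
  obtain ⟨hM, hS⟩ := hn Ψ hE hfin hreal hpos m hm
  have hL := sideLength_succ_pos hρ n
  have hk := norm_waveVec_pos hL hm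
  set κ : ℝ := ‖waveVec (sideLength ρ (n + 1)) m‖ with hκ
  set N : ℝ := (n : ℝ) + 1 with hN
  have hNpos : 0 < N := by positivity
  have hs : 0 < Real.sqrt (κ ^ 2 + Θ * ρ) := Real.sqrt_pos.mpr (by positivity)
  have hm₂ := secondMoment_nonneg' (n + 1) (sideLength ρ (n + 1)) Ψ.ψ m
  have hNS : N * structureFactor n (sideLength ρ (n + 1)) Ψ m ≤ N * (C * κ / Real.sqrt (κ ^ 2 + Θ * ρ)) :=
    mul_le_mul_of_nonneg_left hS hNpos.le
  calc N * structureFactor n (sideLength ρ (n + 1)) Ψ m * secondMoment (n + 1) (sideLength ρ (n + 1)) Ψ.ψ m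
      ≤ (N * (C * κ / Real.sqrt (κ ^ 2 + Θ * ρ))) * (C * N * κ ^ 3 * Real.sqrt (κ ^ 2 + Θ * ρ)) :=
        mul_le_mul hNS hM hm₂ (by positivity)
    _ = C * C * (N ^ 2 * κ ^ 4) := by
        field_simp

/-- **The free gas satisfies the repaired bounds** with `C = 1`, `Θ = 0`, every `ρ₀` (here `1`), every
`n` and every free minimiser (a constant, `exists_eq_const_of_free_minimiser`): `W = ‖k‖²ΨZ`, so
`m₂ = ‖k‖⁴∫|Z|²|Ψ|² = N‖k‖⁴ = N‖k‖³√(‖k‖²)` and `S_m = 1 = ‖k‖/√(‖k‖²)`. [folklore] -/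
theorem momentBoundsTheta_at_free :
    ∃ C : ℝ, 0 ≤ C ∧ ∃ Θ : ℝ, 0 ≤ Θ ∧ ∃ ρ₀ : ℝ, 0 < ρ₀ ∧ ∀ ρ : ℝ, 0 < ρ → ρ < ρ₀ →
      ∀ᶠ n : ℕ in atTop, ∀ Ψ : PeriodicTrialState (n + 1) (sideLength ρ (n + 1)),
        periodicEnergy 0 Ψ = periodicGroundStateEnergy 0 (n + 1) (sideLength ρ (n + 1)) →
        periodicEnergy 0 Ψ ≠ ⊤ → (∀ X, Ψ.ψ X = (‖Ψ.ψ X‖ : ℂ)) → (∀ X, Ψ.ψ X ≠ 0) →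
        ∀ m : Fin 3 → ℤ, m ≠ 0 →
          secondMoment (n + 1) (sideLength ρ (n + 1)) Ψ.ψ m ≤
              1 * ((n : ℝ) + 1) * ‖waveVec (sideLength ρ (n + 1)) m‖ ^ 3 *
                Real.sqrt (‖waveVec (sideLength ρ (n + 1)) m‖ ^ 2 + 0 * ρ) ∧
            structureFactor n (sideLength ρ (n + 1)) Ψ m ≤
              1 * ‖waveVec (sideLength ρ (n + 1)) m‖ /
                Real.sqrt (‖waveVec (sideLength ρ (n + 1)) m‖ ^ 2 + 0 * ρ) := by
  refine ⟨1, zero_le_one, 0, le_rfl, 1, one_pos, fun ρ hρ _ => Filter.Eventually.of_forall fun n => ?_⟩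
  set L := sideLength ρ (n + 1) with hLdef
  have hL : 0 < L := sideLength_succ_pos hρ n
  intro Ψ hE _ _ _ m hm
  have hk := norm_waveVec_pos hL hm
  have hk0 : ‖waveVec L m‖ ≠ 0 := hk.ne'
  have hsq : Real.sqrt (‖waveVec L m‖ ^ 2 + 0 * ρ) = ‖waveVec L m‖ := by
    rw [zero_mul, add_zero, Real.sqrt_sq hk.le]
  obtain ⟨c, hc⟩ := exists_eq_const_of_free_minimiser hL Ψ hE
  have hZ := integral_norm_sq_densityMode_of_const hL Ψ hc hm
  push_cast at hZ
  -- `W = ‖k‖² Ψ Z` (the derivative of a constant vanishes)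
  have hW : ∀ X, commutatorAmp (n + 1) L Ψ.ψ m X =
      ((((‖waveVec L m‖ ^ 2 : ℝ)) : ℂ) * Ψ.ψ X) * ∑ j : Fin (n + 1), cellWave L m (X j) := by
    intro X
    have h0 : fderiv ℝ Ψ.ψ X = 0 := fderiv_eq_zero_of_free_minimiser hL Ψ hE X
    unfold commutatorAmp
    rw [Finset.mul_sum]
    refine Finset.sum_congr rfl fun j _ => ?_
    rw [h0, FunLike.coe_zero, Pi.zero_apply, mul_zero, sub_zero]
    ring
  have hm₂ : secondMoment (n + 1) L Ψ.ψ m = ((n : ℝ) + 1) * ‖waveVec L m‖ ^ 4 := by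
    unfold secondMoment
    have h1 : ∀ X : Config (n + 1), ‖commutatorAmp (n + 1) L Ψ.ψ m X‖ ^ 2 =
        ‖waveVec L m‖ ^ 4 * (‖∑ j : Fin (n + 1), cellWave L m (X j)‖ ^ 2 * ‖Ψ.ψ X‖ ^ 2) := by
      intro X
      rw [hW X, norm_mul, norm_mul, Complex.norm_real, Real.norm_eq_abs,
        abs_of_nonneg (sq_nonneg _)]
      ring
    simp_rw [h1]
    rw [integral_const_mul, hZ]
    ring
  have hS : structureFactor n L Ψ m = 1 := by
    unfold structureFactor
    rw [hZ]
    have hN : ((n : ℝ) + 1) ≠ 0 := by positivity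
    exact inv_mul_cancel₀ hN
  refine ⟨?_, ?_⟩
  · rw [hm₂, hsq]
    exact le_of_eq (by ring)
  · rw [hS, hsq]
    exact le_of_eq (by field_simp)

end Summit.AtomisticToContinuum.BoseEinsteinCondensation.Cruxes.InfraredMinimumUncertainty.DrefuteRepair

end
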